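import Summits.RiemannHypothesis.RiemannHypothesis.Theorems.SuzukiKernelSemigroup
import Mathlib.Analysis.SpecialFunctions.ImproperIntegrals

/-!
# The polar part of the `θ`-flow generator acts by one-sided exponential convolution (column DBR; RH-FREE)

RH-FREE throughout; nothing here bears on the truth of RH.

Second piece of the decomposition `J_θ = k ∗ K_θ` behind `FlowPairing` (`Theorems.SuzukiThetaFlowDefs`): in
`L(z) = −2ξ'/ξ(s)`, `s = ½ − iz`, the POLAR PART is `−2(1/s + 1/(s−1))`, and on the line `Im z = 1` the factors
`1/(s − 1)` and `1/s` are the one-sided transforms of `e^{x/2}𝟙_{x>0}` and `e^{−x/2}𝟙_{x>0}`: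

* `invFourierLine_one_eq_cexp_mul_fourierInv` — the bridge to Mathlib's transform on the line `Im z = 1`:
  `invFourierLine Ψ 1 x = eˣ · 𝓕⁻ (ξ ↦ Ψ(−2πξ + i)) x` (pure change of variables);
* `fourier_expDamped_Ioi` — `𝓕 (v ↦ 𝟙_{v>0} e^{−cv}) ξ = 1/(c + 2πiξ)` (`Re c > 0`);
* **`invFourierLine_inv_sub_mul_limTheta`** — for `θ > 1`, `a < 1` and real `x`, with `s = ½ − iz`:
  `invFourierLine (z ↦ Θ_θ(z)/(s − (½ + a))) 1 x = ∫_ℝ 𝟙_{v>0} e^{av} K_θ(x − v) dv`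
  (so `1/(s−1) ↔ a = ½`, `1/s ↔ a = −½`): Fourier uniqueness on the damped functions, as in
  `Theorems.SuzukiKernelSemigroup` (`Real.fourier_mul_convolution_eq`, `Continuous.fourierInv_fourier_eq`).

References: [Su20] M. Suzuki, ASPM 84 (2020) = arXiv:1907.07302, (1.9); Bombieri, Rend. Lincei (9) 11 (2000), Thm 2
(the polar term `ĝ(0) + ĝ(1)` of the tree's `weilPolarTerm`).
-/

noncomputable section

-- D-0017: `Summit.<S>.<S>.…` is the designed namespace of a single-problem summit.
set_option linter.dupNamespace false

open Complex MeasureTheory Filter Topology Set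
open scoped Real FourierTransform Convolution

namespace Summit.RiemannHypothesis.RiemannHypothesis.Theorems.SuzukiKernelSemigroup

open Literature.NumberTheory.LFunctions

/-! ## §1 The bridge between `invFourierLine` on `Im z = 1` and Mathlib's `𝓕⁻` -/

/-- RH-FREE.  `invFourierLine Ψ 1 x = eˣ · 𝓕⁻ (ξ ↦ Ψ(−2πξ + i)) x` (substitute `u = −2πξ` in
`(2π)⁻¹ ∫ Ψ(u+i) e^{−i(u+i)x} du`). -/
theorem invFourierLine_one_eq_cexp_mul_fourierInv (Ψ : ℂ → ℂ) (x : ℝ) :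
    invFourierLine Ψ 1 x =
      Complex.exp (x : ℂ) * 𝓕⁻ (fun ξ : ℝ => Ψ ((((-(2 * π)) * ξ : ℝ) : ℂ) + I)) x := by
  rw [Real.fourierInv_eq_fourier_neg, Real.fourier_real_eq_integral_exp_smul]
  set G : ℝ → ℂ := fun u => Complex.exp (-I * (u : ℂ) * (x : ℂ)) * Ψ ((u : ℂ) + I) with hG
  have hsub : ∫ v : ℝ, Complex.exp (↑(-2 * π * v * -x) * I) • Ψ ((((-(2 * π)) * v : ℝ) : ℂ) + I) =
      ∫ v : ℝ, G ((-(2 * π)) * v) := by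
    congr 1; funext v
    rw [hG, smul_eq_mul]
    simp only
    congr 1
    · congr 1; push_cast; ring
  rw [hsub, Measure.integral_comp_mul_left G]
  have habs : |(-(2 * π))⁻¹| = (2 * π)⁻¹ := by
    rw [abs_inv, abs_neg, abs_of_pos (by positivity)]
  rw [habs]
  unfold invFourierLine
  rw [← integral_const_mul, Complex.real_smul, ← mul_assoc, ← integral_const_mul]
  congr 1; funext u
  rw [hG]
  have e : Complex.exp (-I * ((u : ℂ) + ((1 : ℝ) : ℂ) * I) * (x : ℂ)) =
      Complex.exp (x : ℂ) * Complex.exp (-I * (u : ℂ) * (x : ℂ)) := by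
    rw [← Complex.exp_add]; congr 1; push_cast; linear_combination (-(x : ℂ)) * I_mul_I
  rw [e]
  push_cast
  ring

/-! ## §2 The one-sided exponentials and their transforms -/

/-- RH-FREE.  `𝓕 (v ↦ 𝟙_{(0,∞)}(v) e^{−cv}) ξ = 1/(c + 2πiξ)` for `Re c > 0`. -/
theorem fourier_expDamped_Ioi {c : ℂ} (hc : 0 < c.re) (ξ : ℝ) :
    𝓕 (fun v : ℝ => (Ioi (0 : ℝ)).indicator (fun v : ℝ => Complex.exp (-c * (v : ℂ))) v) ξ =
      1 / (c + 2 * π * I * ξ) := by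
  rw [Real.fourier_real_eq_integral_exp_smul]
  have hre : (-(c + 2 * π * I * ξ)).re < 0 := by
    simp only [neg_re, add_re, mul_re, re_ofNat, ofReal_re, im_ofNat, ofReal_im, mul_zero, sub_zero, mul_im,
      zero_mul, add_zero, I_re, I_im, mul_one]
    linarith
  have h := integral_exp_mul_complex_Ioi hre 0
  simp only [ofReal_zero, mul_zero, Complex.exp_zero] at h
  have hset : ∫ v : ℝ, Complex.exp (↑(-2 * π * v * ξ) * I) •
      (Ioi (0 : ℝ)).indicator (fun v : ℝ => Complex.exp (-c * (v : ℂ))) v =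
      ∫ v in Ioi (0 : ℝ), Complex.exp (-(c + 2 * π * I * ξ) * (v : ℂ)) := by
    rw [← integral_indicator measurableSet_Ioi]
    congr 1; funext v
    by_cases hv : v ∈ Ioi (0 : ℝ)
    · rw [Set.indicator_of_mem hv, Set.indicator_of_mem hv, smul_eq_mul, ← Complex.exp_add]
      congr 1; push_cast; ring
    · rw [Set.indicator_of_notMem hv, Set.indicator_of_notMem hv, smul_zero]
  rw [hset, h]
  have hne : c + 2 * π * I * ξ ≠ 0 := by
    intro h0
    have := congrArg Complex.re h0
    simp at this
    linarith
  field_simp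

/-- RH-FREE.  The damped one-sided exponential `v ↦ 𝟙_{v>0} e^{−cv}` (`c > 0` real) is integrable and bounded by `1`. -/
theorem integrable_expDamped_Ioi {c : ℝ} (hc : 0 < c) :
    Integrable fun v : ℝ => (Ioi (0 : ℝ)).indicator (fun v : ℝ => Complex.exp (-(c : ℂ) * (v : ℂ))) v := by
  refine IntegrableOn.integrable_indicator ?_ measurableSet_Ioi
  have h := integrableOn_exp_mul_complex_Ioi (a := -(c : ℂ)) (by simpa using hc) 0
  exact h

/-- RH-FREE.  `‖𝟙_{v>0} e^{−cv}‖ ≤ 1` for `c > 0`. -/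
theorem norm_expDamped_Ioi_le {c : ℝ} (hc : 0 < c) (v : ℝ) :
    ‖(Ioi (0 : ℝ)).indicator (fun v : ℝ => Complex.exp (-(c : ℂ) * (v : ℂ))) v‖ ≤ 1 := by
  by_cases hv : v ∈ Ioi (0 : ℝ)
  · rw [Set.indicator_of_mem hv, Complex.norm_exp]
    simp only [neg_mul, neg_re, mul_re, ofReal_re, ofReal_im, mul_zero, sub_zero]
    exact Real.exp_le_one_iff.2 (by nlinarith [mem_Ioi.1 hv])
  · rw [Set.indicator_of_notMem hv, norm_zero]; exact zero_le_one

/-! ## §3 The polar factors act by one-sided exponential convolution -/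

/-- **RH-FREE · the polar part of the flow generator**: for `θ > 1`, `a < 1` and real `x`, with `s = ½ − iz`,
`invFourierLine (z ↦ Θ_θ(z) / (s − (½ + a))) 1 x = ∫_ℝ 𝟙_{v>0} e^{av} K_θ(x − v) dv` (`= ∫₀^{x} e^{av} K_θ(x−v) dv`):
`a = ½` is the factor `1/(s−1)`, `a = −½` the factor `1/s` of `L = −2ξ'/ξ(s)`. -/
theorem invFourierLine_inv_sub_mul_limTheta {θ : ℝ} (hθ : 1 < θ) {a : ℝ} (ha : a < 1) (x : ℝ) :
    invFourierLine (fun z : ℂ => limTheta θ z / ((1 / 2 - I * z) - (1 / 2 + (a : ℂ)))) 1 x =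
      ∫ v : ℝ, (((Ioi (0 : ℝ)).indicator (fun v : ℝ => Real.exp (a * v)) v : ℝ) : ℂ) *
        (limKernel θ (x - v) : ℂ) := by
  -- the damped factors
  set c : ℝ := 1 - a with hc
  have hc0 : 0 < c := by rw [hc]; linarith
  set g₁ : ℝ → ℂ := fun v => (Ioi (0 : ℝ)).indicator (fun v : ℝ => Complex.exp (-(c : ℂ) * (v : ℂ))) v with hg₁
  set fθ : ℝ → ℂ := fun y => (limKernel θ y : ℂ) * Complex.exp (-(y : ℂ)) with hfθ
  have hg₁i : Integrable g₁ := integrable_expDamped_Ioi hc0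
  have hfθi : Integrable fθ := integrable_damped hθ
  -- the convolution `H = g₁ ⋆ fθ`: continuous, integrable, transform integrable
  set H : ℝ → ℂ := g₁ ⋆[ContinuousLinearMap.mul ℂ ℂ] fθ with hH
  have hHc : Continuous H :=
    (bddAbove_norm_damped hθ).continuous_convolution_right_of_integrable (L := ContinuousLinearMap.mul ℂ ℂ)
      hg₁i (continuous_damped hθ)
  have hHi : Integrable H := hg₁i.integrable_convolution _ hfθi
  have hFH : ∀ ξ : ℝ, 𝓕 H ξ = 1 / ((c : ℂ) + 2 * π * I * ξ) * limTheta θ (((-2 * π * ξ : ℝ) : ℂ) + I) := by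
    intro ξ
    rw [hH, Real.fourier_mul_convolution_eq hg₁i hfθi ξ, hg₁, fourier_expDamped_Ioi (by simpa using hc0),
      hfθ, fourier_damped hθ]
  have hFHi : Integrable (𝓕 H) := by
    have h2 : Integrable fun ξ : ℝ => limTheta θ ((((-(2 * π)) * ξ : ℝ) : ℂ) + ((1 : ℝ) : ℂ) * I) :=
      (integrable_limTheta_line hθ (b := 1) (by norm_num)).comp_mul_left' (neg_ne_zero.2 (by positivity))
    refine (h2.norm.const_mul (1 / c)).mono' ?_ (Eventually.of_forall fun ξ => ?_)
    · exact (VectorFourier.fourierIntegral_continuous Real.continuous_fourierChar (by exact continuous_inner)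
        hHi).aestronglyMeasurable
    rw [hFH ξ, norm_mul]
    have hden : c ≤ ‖(c : ℂ) + 2 * π * I * ξ‖ := by
      have h1 := Complex.abs_re_le_norm ((c : ℂ) + 2 * π * I * ξ)
      have h2 : ((c : ℂ) + 2 * π * I * ξ).re = c := by simp
      rw [h2, abs_of_pos hc0] at h1
      exact h1
    have hinv : ‖1 / ((c : ℂ) + 2 * π * I * ξ)‖ ≤ 1 / c := by
      rw [norm_div, norm_one]
      exact one_div_le_one_div_of_le hc0 hden
    have e : limTheta θ (((-2 * π * ξ : ℝ) : ℂ) + I) = limTheta θ ((((-(2 * π)) * ξ : ℝ) : ℂ) + ((1 : ℝ) : ℂ) * I) := by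
      congr 1; push_cast; ring
    rw [e]
    exact mul_le_mul_of_nonneg_right hinv (norm_nonneg _)
  -- Fourier inversion for `H`
  have hinv := congrFun (hHc.fourierInv_fourier_eq hHi hFHi) x
  -- the left side through the bridge
  rw [invFourierLine_one_eq_cexp_mul_fourierInv]
  have hΨ : (fun ξ : ℝ => (fun z : ℂ => limTheta θ z / ((1 / 2 - I * z) - (1 / 2 + (a : ℂ))))
      ((((-(2 * π)) * ξ : ℝ) : ℂ) + I)) = 𝓕 H := by
    funext ξ
    rw [hFH ξ]
    simp only
    have e1 : (1 / 2 - I * ((((-(2 * π)) * ξ : ℝ) : ℂ) + I)) - (1 / 2 + (a : ℂ)) = (c : ℂ) + 2 * π * I * ξ := by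
      rw [hc]; push_cast; linear_combination (-1 : ℂ) * I_mul_I
    have e2 : limTheta θ ((((-(2 * π)) * ξ : ℝ) : ℂ) + I) = limTheta θ (((-2 * π * ξ : ℝ) : ℂ) + I) := by
      congr 1; push_cast; ring
    rw [e1, e2]
    ring
  rw [hΨ, hinv, hH, convolution_mul]
  -- undamp: `eˣ ∫ g₁(v) fθ(x − v) dv = ∫ 𝟙_{v>0} e^{av} K_θ(x−v) dv`
  rw [← integral_const_mul]
  congr 1; funext v
  rw [hg₁, hfθ]
  simp only
  by_cases hv : v ∈ Ioi (0 : ℝ)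
  · rw [Set.indicator_of_mem hv, Set.indicator_of_mem hv]
    have e : Complex.exp (x : ℂ) * (Complex.exp (-(c : ℂ) * (v : ℂ)) * Complex.exp (-((x - v : ℝ) : ℂ))) =
        ((Real.exp (a * v) : ℝ) : ℂ) := by
      rw [← Complex.exp_add, ← Complex.exp_add, Complex.ofReal_exp]
      congr 1; rw [hc]; push_cast; ring
    calc Complex.exp (x : ℂ) * (Complex.exp (-(c : ℂ) * (v : ℂ)) * ((limKernel θ (x - v) : ℂ) *
          Complex.exp (-((x - v : ℝ) : ℂ))))
        = (Complex.exp (x : ℂ) * (Complex.exp (-(c : ℂ) * (v : ℂ)) * Complex.exp (-((x - v : ℝ) : ℂ)))) *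
            (limKernel θ (x - v) : ℂ) := by ring
      _ = ((Real.exp (a * v) : ℝ) : ℂ) * (limKernel θ (x - v) : ℂ) := by rw [e]
  · rw [Set.indicator_of_notMem hv, Set.indicator_of_notMem hv]
    simp

end Summit.RiemannHypothesis.RiemannHypothesis.Theorems.SuzukiKernelSemigroup

end
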